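import Summits.CriticalPhenomena.Ising3DConformalLimit.Theses.SubPtolemyInterlacing
import Literature.Probability.LatticeModels.CriticalUrsellFourSign
import Literature.Probability.LatticeModels.CriticalAxisRatioRegularity
import HarnessLib

/-!
# Line `Sketch` for the crux `SubPtolemyInterlacing.Interlacing` (stmt-CriticalPhenomena-15702) — stub `stub_axisPair`

The axis dictionary: `criticalCorr 3 2 ![m e₁, n e₁] = ⟨σ₀ σ_{(n-m) e₁}⟩_{β_c}` for `m ≤ n` (translation invariance).

Helper file of the line `Sketch` (lead skeleton `Cruxes/Interlacing/Lines/Sketch.lean`): proves the registered stub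
`stub_axisPair` verbatim (name + signature). No definitions, no named facts, no sorry.
-/

noncomputable section

namespace Summit.CriticalPhenomena.Ising3DConformalLimit.Cruxes.Interlacing.Sketch

open Filter MeasureTheory
open scoped symmDiff Topology
open Literature.Probability.LatticeModels Literature.Probability.Percolation

/-- **Stub `stub_axisPair`** of the line `Sketch` (crux stmt-CriticalPhenomena-15702): The axis dictionary: `criticalCorr 3 2 ![m e₁, n e₁] = ⟨σ₀ σ_{(n-m) e₁}⟩_{β_c}` for `m ≤ n` (translation invariance). -/
theorem stub_axisPair : ∀ m n : ℕ, m ≤ n →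
    criticalCorr 3 2 ![((m : ℕ) : ℤ) • (Pi.single 0 1 : Site 3), ((n : ℕ) : ℤ) • (Pi.single 0 1 : Site 3)] =
      criticalTwoPoint 3 (Pi.single 0 ((n - m : ℕ) : ℤ)) := by
  intro m n hmn
  rw [criticalCorr_two_pair, ← sub_smul, Nat.cast_sub hmn]
  congr 1
  ext i
  by_cases hi : i = 0
  · subst hi; simp
  · simp [hi]

end Summit.CriticalPhenomena.Ising3DConformalLimit.Cruxes.Interlacing.Sketch

end
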